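import Summits.HodgeConjecture.HodgeConjecture.Theorems.PadicSemiregularLiftFormalLiftingFromClassLiftingUnobstructed
import Literature.AlgebraicGeometry.Modules.ExtCohomologyComparison
import Literature.AlgebraicGeometry.Dimension.SmoothRelativeDimensionBound
import Literature.AlgebraicGeometry.Modules.TensorUnitors
import Literature.AlgebraicGeometry.Motives.VarietiesQuasiCompactProofs
import Mathlib.RingTheory.KrullDimension.Field
import HarnessLib

/-!
# `FormalLiftingFromClassLifting` (stmt-HodgeConjecture-13825) · relative dimension `d ≤ 1`, all ranks, unconditionally

Crux P1a of route `HodgeConjecture/PadicSemiregularLift` (formal object lifting from rational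
pro-class lifting, for a finite locally free `E₁` on the special fibre `X_k` of a Hodge-torsion-free
smooth proper model `𝒳/W(k)` of relative dimension `d`). In rank `≥ 2` and `d ≥ 2` its closure
rests on X. Hu's infinitesimal `K₀`-lifting criterion (named facts
`KTheory.HuKZeroLiftingCriterion` / `HuKZeroKernelPresentation`). This file closes the case of
RELATIVE CURVES, `d ≤ 1`, in every rank and with no `K`-theory, no class-lifting hypothesis and no
torsion hypothesis: on the smooth projective curve `X_k` the Illusie obstruction group
`Ext²_{X_k}(E₁, E₁ ⊗ 𝒪)` vanishes, because for `E₁` finite locally free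
`Ext²_{𝒪}(E₁, M) ≅ H²(X_k, 𝓗om(E₁, M))` (Hartshorne III.6.3 (c) + III.6.7, the tree's
`Modules.extToCohomology_bijective` / `Modules.extToExtUnitSheafHom_bijective`) and `H² = 0` on a
noetherian space of dimension `≤ 1` (Grothendieck, Hartshorne III.2.7,
`Motives.grothendieckVanishing_holds`) — so the unobstructed corner
`Unobstructed.liftsFormally_of_subsingleton_obstructionGroup` (Illusie's obstruction theory of crux
P1b and the climb `Glue.liftsFormally_of_stepClassLifting`) applies.

* `noetherianSpace_specialFibre`, `topologicalKrullDim_specialFibre_le` — the special fibre of a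
  smooth proper model of relative dimension `d` is a noetherian space of dimension `≤ d`;
* `subsingleton_obstructionGroup_of_le_one` — `Ext²(E₁, E₁ ⊗ 𝒪) = 0` for `d ≤ 1`;
* `liftsFormally_of_le_one` — every finite locally free `E₁` on `X_k` lifts formally when `d ≤ 1`;
* `liftsFormally_of_subsingleton_H_two_sheafHom` — in any dimension, `H²(X_k, 𝓔nd E₁) = 0` ⇒
  `E₁` lifts formally;
* `formalLiftingFromClassLifting_of_le_one` — the crux's literal signature with `d ≤ 1` inserted
  (the registered sub-goal of stmt-HodgeConjecture-13825 this file serves).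
-/

noncomputable section

open CategoryTheory CategoryTheory.Abelian AlgebraicGeometry TopologicalSpace
open Literature.AlgebraicGeometry Literature.AlgebraicGeometry.Motives
  Literature.AlgebraicGeometry.Motives.WittScheme Literature.AlgebraicGeometry.Deformation
  Literature.AlgebraicGeometry.Modules

-- the mandated namespace `Summit.HodgeConjecture.HodgeConjecture.…` repeats a component
set_option linter.dupNamespace false

namespace Summit.HodgeConjecture.HodgeConjecture.Theorems.FormalLiftingFromClassLifting.Curves

open Summit.HodgeConjecture.HodgeConjecture.Theorems.FormalLiftingFromClassLifting.Unobstructed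
  (liftsFormally_of_subsingleton_obstructionGroup)

variable {p : ℕ} [Fact p.Prime] {k : Type} [Field k] [CharP k p] {d : ℕ}
  {𝒳 : SchemeOver (WittVector p k)}

/-- The special fibre of a smooth proper model is a noetherian topological space (a smooth
projective variety over a field: locally noetherian and quasi-compact). [folklore] -/
theorem noetherianSpace_specialFibre (h𝒳 : IsSmoothProperModel d 𝒳) :
    NoetherianSpace (specialFibre 𝒳).left := by
  haveI := IsSmoothProjective.isLocallyNoetherian_holds h𝒳.isSmoothProjective_specialFibre
  haveI := IsSmoothProjective.compactSpace_holds h𝒳.isSmoothProjective_specialFibre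
  haveI : IsNoetherian (specialFibre 𝒳).left := {}
  infer_instance

/-- The special fibre of a smooth proper model of relative dimension `d` has (topological Krull)
dimension at most `d` (smooth of relative dimension `d` over the field `k`). [folklore] -/
theorem topologicalKrullDim_specialFibre_le (h𝒳 : IsSmoothProperModel d 𝒳) :
    topologicalKrullDim (specialFibre 𝒳).left ≤ (d : WithBot ℕ∞) := by
  haveI := h𝒳.isSmoothProjective_specialFibre.smoothOfRelativeDimension
  have h := Literature.AlgebraicGeometry.Dimension.topologicalKrullDim_le_of_smoothOfRelativeDimension_of_le
    (R := CommRingCat.of k) (specialFibre 𝒳).hom d (e := 0)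
    (le_of_eq (ringKrullDim_eq_zero_of_field k))
  simpa using h

/-- **On relative curves the obstruction group vanishes**: for a smooth proper model `𝒳/W(k)` of
relative dimension `d ≤ 1` and a finite locally free `E₁` on the special fibre `X_k`,
`Ext²_{X_k}(E₁, E₁ ⊗ 𝒪) = 0` — indeed `Ext²_{𝒪}(E₁, M) = H²(X_k, 𝓗om(E₁, M)) = 0` on the
`≤ 1`-dimensional noetherian space `X_k` (Hartshorne III.6.7 + Grothendieck vanishing III.2.7,
`Modules.subsingleton_ext_of_topologicalKrullDim_lt`). [cite: Hartshorne1977, III Prop. 6.7 and Thm. 2.7] -/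
theorem subsingleton_obstructionGroup_of_le_one (h𝒳 : IsSmoothProperModel d 𝒳) (hd : d ≤ 1)
    {E₁ : (specialFibre 𝒳).left.Modules} (hE₁ : IsFiniteLocallyFree E₁) :
    Subsingleton (obstructionGroup 2 E₁ (unitModule (specialFibre 𝒳).left)) := by
  haveI := noetherianSpace_specialFibre h𝒳
  refine subsingleton_ext_of_topologicalKrullDim_lt hE₁ _ ?_
  refine lt_of_le_of_lt (topologicalKrullDim_specialFibre_le h𝒳) ?_
  have : (d : ℕ∞) < 2 := by exact_mod_cast Nat.lt_succ_of_le hd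
  exact_mod_cast this

/-- **The crux `FormalLiftingFromClassLifting` for relative dimension `d ≤ 1`, in every rank and
unconditionally**: a finite locally free `E₁` on the special fibre of a smooth proper model
`𝒳/W(k)` of relative dimension `≤ 1` lifts formally — the obstruction group `Ext²(E₁, E₁ ⊗ 𝒪)`
vanishes on a curve, so the unobstructed corner
(`Unobstructed.liftsFormally_of_subsingleton_obstructionGroup`: Illusie's obstruction theory,
crux P1b, and the climb `Glue.liftsFormally_of_stepClassLifting`) applies. No hypothesis of the
crux other than smoothness/properness is used. [cite: Illusie1971, IV Prop. 3.1.5] -/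
theorem liftsFormally_of_le_one [PerfectRing k p] (h𝒳 : IsSmoothProperModel d 𝒳) (hd : d ≤ 1)
    {E₁ : (specialFibre 𝒳).left.Modules} (hE₁ : IsFiniteLocallyFree E₁) :
    LiftsFormally 𝒳 E₁ :=
  liftsFormally_of_subsingleton_obstructionGroup h𝒳 hE₁
    (subsingleton_obstructionGroup_of_le_one h𝒳 hd hE₁)


/-- **A cohomological lifting criterion in any dimension**: on a smooth proper model `𝒳/W(k)`, a
finite locally free `E₁` on the special fibre with `H²(X_k, 𝓔nd(E₁)) = 0` lifts formally — the
obstruction group `Ext²(E₁, E₁ ⊗ 𝒪) ≅ Ext²(E₁, E₁) ≅ H²(X_k, 𝓗om(E₁, E₁))`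
(`Modules.extAddEquivCohomologySheafHom`, Hartshorne III.6.3 (c) + III.6.7) vanishes, so the
unobstructed corner applies (classical: Illusie / SGA 1 III, "`H²(X₀, 𝓔nd(E₀)) = 0` ⇒ `E₀` lifts").
[cite: Illusie1971, IV Prop. 3.1.5] -/
theorem liftsFormally_of_subsingleton_H_two_sheafHom [PerfectRing k p] (h𝒳 : IsSmoothProperModel d 𝒳)
    {E₁ : (specialFibre 𝒳).left.Modules} (hE₁ : IsFiniteLocallyFree E₁)
    [Subsingleton (((Literature.AlgebraicGeometry.HodgeTheory.modulesToSheaf (specialFibre 𝒳).left).obj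
      (sheafHom E₁ E₁)).H 2)] :
    LiftsFormally 𝒳 E₁ := by
  haveI : Subsingleton (Ext E₁ E₁ 2) := subsingleton_ext_of_subsingleton_H_sheafHom hE₁ E₁ 2
  haveI : Subsingleton (obstructionGroup 2 E₁ (unitModule (specialFibre 𝒳).left)) :=
    (extTensorUnitRightEquiv E₁ E₁ 2).toEquiv.subsingleton
  exact liftsFormally_of_subsingleton_obstructionGroup h𝒳 hE₁ inferInstance

/-- **The crux `FormalLiftingFromClassLifting` (stmt-HodgeConjecture-13825) in relative dimension
`d ≤ 1`** — its literal signature with the extra hypothesis `d ≤ 1`, all ranks, unconditionally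
(hypothesis (⋆), the rational pro-class, projectivity, `d + 6 < p` and the torsion-freeness of
Hodge cohomology are not needed on relative curves). [cite: Illusie1971, IV Prop. 3.1.5] -/
theorem formalLiftingFromClassLifting_of_le_one :
    ∀ (p : ℕ) [Fact p.Prime] (k : Type) [Field k] [CharP k p] [PerfectRing k p] (d : ℕ)
      (𝒳 : SchemeOver (WittVector p k)), IsSmoothProperModel d 𝒳 →
      Literature.AlgebraicGeometry.Crystalline.IsProjectiveOverRing 𝒳 → d + 6 < p → d ≤ 1 →
      (∀ (b : ℕ) (x : structureSheafCohomology 𝒳.left b), (p : ℤ) • x = 0 → x = 0) →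
      (∀ (b : ℕ) (x : hodgeCohomologyOne 𝒳 b), (p : ℤ) • x = 0 → x = 0) →
      (d ≤ 3 ∨ Nonempty (cotangentSheaf 𝒳 ≅ SheafOfModules.free (R := 𝒳.left.ringCatSheaf) (Fin d))) →
      ∀ (E₁ : (specialFibre 𝒳).left.Modules) (hE₁ : IsFiniteLocallyFree E₁),
        (∀ (n : ℕ) (F : (thickening 𝒳 (n + 1)).left.Modules) (hF : IsFiniteLocallyFree F),
          Nonempty ((Scheme.Modules.pullback (specialFibreToThickening 𝒳 n)).obj F ≅ E₁) →
          (∃ y : KTheory.KZero (thickening 𝒳 (n + 2)).left,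
            KTheory.KZero.map (thickeningMap 𝒳 (Nat.le_succ (n + 1))) y = KTheory.KZero.of F hF) →
          ∃ F' : (thickening 𝒳 (n + 2)).left.Modules, IsFiniteLocallyFree F' ∧
            Nonempty ((Scheme.Modules.pullback (thickeningMap 𝒳 (Nat.le_succ (n + 1)))).obj F' ≅ F)) →
        (∃ ξ : KTheory.ContinuousKZeroRat (Ideal.span {(p : WittVector p k)}) 𝒳,
          KTheory.KZeroRat.map (Literature.AlgebraicGeometry.Crystalline.specialFibreToTower 𝒳)
            (KTheory.ContinuousKZeroRat.specialFibre (Ideal.span {(p : WittVector p k)}) 𝒳 ξ) =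
            KTheory.KZeroRat.of E₁ hE₁) →
        LiftsFormally 𝒳 E₁ :=
  fun _p _ _k _ _ _ _d _𝒳 h𝒳 _ _ hd _ _ _ _E₁ hE₁ _ _ => liftsFormally_of_le_one h𝒳 hd hE₁

end Summit.HodgeConjecture.HodgeConjecture.Theorems.FormalLiftingFromClassLifting.Curves

end
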